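import Literature.RepresentationTheory.Semisimple.MultiplicityDecomposition
import Literature.NumberTheory.GaloisRepresentations.TwistedSumCombinatorics
import Mathlib.Algebra.BigOperators.Group.Finset.Sigma
import Mathlib.Data.Fintype.Sigma
import HarnessLib

/-!
# Twisted sums of semisimple representations: the algebraic core of HLTT Prop. 7.12

Topic `Literature/NumberTheory/GaloisRepresentations` (theorems only).  This is the
representation-theoretic heart of our proof of Harris–Lan–Taylor–Thorne, *On the rigid
cohomology of certain Shimura varieties*, Res. Math. Sci. 3:37 (2016), Prop. 7.12
(`HarrisLanTaylorThorne2016.prop712Hausdorff`, discharged in `TwistedSumDecompositionProofs` via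
`TwistedSumAssembly`).  The source (pp. 226–232) argues with the reductive Zariski closure of
the image of `μ ⊕ ⊕ₘ ρ_m` and the characters of its central torus; Mathlib has no linear
algebraic groups, and we replace that argument by multiplicities of twists and the
combinatorial lemma of `TwistedSumCombinatorics`.

**Main result** (`TwistedSum.exists_isCompl_forall_equiv_prod_twist`).  Let `k` be
algebraically closed, `Γ` a group, `μ : Γ → kˣ` a character with `μ(g₀)` of infinite order for
some `g₀`, `ℳ ⊆ ℤ` unbounded above and `R_m` (`m ∈ ℳ`) finite-dimensional semisimple
representations of `Γ` on one space satisfying the *three-term equivalences*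
`R_{m₁} ⊗ μ^{m₂} ⊕ R_{m₂} ⊗ μ^{m₃} ⊕ R_{m₃} ⊗ μ^{m₁} ≃ R_{m₁} ⊗ μ^{m₃} ⊕ R_{m₂} ⊗ μ^{m₁} ⊕ R_{m₃} ⊗ μ^{m₂}`
(`m₁, m₂, m₃ ∈ ℳ`).  Then for some `m₀ ∈ ℳ` there are complementary semisimple subrepresentations
`A`, `B` of `R_{m₀}` with `R_m ≃ A ⊕ B ⊗ μ^{m-m₀}` for all sufficiently large `m ∈ ℳ`.

*Proof.*  Decompose each `R_m` into irreducibles `T_{m,i}` (`Representation.exists_decomposition`)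
and call two constituents equivalent when one is a `μ`-power twist of the other; by freeness of
twisting (`Representation.eq_zero_of_equiv_twist_zpow`) each constituent is `U_c ⊗ μⁿ` for a
unique exponent `n`, `U_c` the chosen representative of its class `c`.  The multiplicity
`p c m n = [R_m : U_c ⊗ μⁿ]` is a fibre cardinality, has partial sums `≤ dim` (mass bound,
`Representation.sum_mult_le_finrank`) and satisfies the three-term identity (additivity and
twist-invariance of multiplicities applied to the three-term equivalences).  The combinatorial
lemma `TwistedSum.exists_eq_add_shift` gives `p c m n = q₁ c n + q₂ c (n - m)` for large `m`,
class by class, and only the finitely many classes met in two fixed `R_{m₀} ⊕ R_{m₁}` occur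
(`eq_zero_of_three_term`).  The direct sums `σᵢ = ⊕ (U_c ⊗ μⁿ)^{qᵢ c n}`
(`Representation.pi`, `mult_twist_pi_eq`) then have the same multiplicities as required, so
`R_m ≃ σ₁ ⊕ σ₂ ⊗ μᵐ` by Krull–Schmidt (`Representation.nonempty_equiv_of_mult_eq`); transporting
`σ₁`, `σ₂ ⊗ μ^{m₀}` into `R_{m₀}` along such an equivalence gives `A`, `B`.

## References

* M. Harris, K.-W. Lan, R. Taylor, J. Thorne, *On the rigid cohomology of certain Shimura
  varieties*, Res. Math. Sci. 3:37 (2016), §7, pp. 225–232. [HarrisLanTaylorThorneRMS2016]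
-/

noncomputable section

namespace Literature.NumberTheory.GaloisRepresentations

namespace TwistedSum

open Literature.RepresentationTheory.Semisimple Literature.RepresentationTheory.FiniteGroups

universe u v w

variable {k : Type u} [Field k] {Γ : Type v} [Group Γ]

/-! ### Twisting by powers of a fixed character -/

section TwistPow

variable {V : Type w} [AddCommGroup V] [Module k V] {W : Type w} [AddCommGroup W] [Module k W]
  {X : Type w} [AddCommGroup X] [Module k X] (μ : Γ →* kˣ)

/-- `(ρ ⊗ μᵃ) ⊗ μᵇ = ρ ⊗ μ^{a+b}`. [folklore] -/
theorem twist_zpow_twist_zpow (ρ : Representation k Γ V) (a b : ℤ) :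
    Representation.twist (Representation.twist ρ (μ ^ a)) (μ ^ b) =
      Representation.twist ρ (μ ^ (a + b)) := by
  rw [Representation.twist_twist]
  exact congrArg _ (zpow_add μ a b).symm

/-- `ρ ⊗ μ⁰ = ρ`. [folklore] -/
theorem twist_zpow_zero (ρ : Representation k Γ V) :
    Representation.twist ρ (μ ^ (0 : ℤ)) = ρ := by
  rw [show μ ^ (0 : ℤ) = 1 from zpow_zero μ, Representation.twist_one]

/-- Symmetry of twist-equivalence: `ρ ≃ σ ⊗ μᵃ` gives `σ ≃ ρ ⊗ μ^{-a}`. [folklore] -/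
theorem nonempty_equiv_twist_symm {ρ : Representation k Γ V} {σ : Representation k Γ W} {a : ℤ}
    (e : Representation.Equiv ρ (Representation.twist σ (μ ^ a))) :
    Nonempty (Representation.Equiv σ (Representation.twist ρ (μ ^ (-a)))) := by
  have e' := (Representation.Equiv.twist e (μ ^ (-a))).symm
  rw [twist_zpow_twist_zpow, add_neg_cancel, twist_zpow_zero] at e'
  exact ⟨e'⟩

/-- Transitivity of twist-equivalence. [folklore] -/
theorem nonempty_equiv_twist_trans {ρ : Representation k Γ V} {σ : Representation k Γ W}
    {τ : Representation k Γ X} {a b : ℤ}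
    (e₁ : Representation.Equiv ρ (Representation.twist σ (μ ^ a)))
    (e₂ : Representation.Equiv σ (Representation.twist τ (μ ^ b))) :
    Nonempty (Representation.Equiv ρ (Representation.twist τ (μ ^ (b + a)))) := by
  have e' := Representation.Equiv.twist e₂ (μ ^ a)
  rw [twist_zpow_twist_zpow] at e'
  exact ⟨e₁.trans e'⟩

/-- Two twists `ρ ⊗ μᵃ ≃ σ ⊗ μᵇ` compare `ρ` with `σ ⊗ μ^{b-a}`. [folklore] -/
theorem nonempty_equiv_of_twist_equiv_twist {ρ : Representation k Γ V} {σ : Representation k Γ W}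
    {a b : ℤ}
    (e : Representation.Equiv (Representation.twist ρ (μ ^ a)) (Representation.twist σ (μ ^ b))) :
    Nonempty (Representation.Equiv ρ (Representation.twist σ (μ ^ (b - a)))) := by
  have e' := Representation.Equiv.twist e (μ ^ (-a))
  rw [twist_zpow_twist_zpow, twist_zpow_twist_zpow, add_neg_cancel, twist_zpow_zero,
    ← sub_eq_add_neg] at e'
  exact ⟨e'⟩

/-- Shifting the twist from the irreducible to the representation:
`[ρ : U ⊗ μ^{a-b}] = [ρ ⊗ μᵇ : U ⊗ μᵃ]`. [folklore] -/
theorem mult_twist_zpow_sub (U : Representation k Γ X) (ρ : Representation k Γ V) (a b : ℤ) :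
    Representation.mult (Representation.twist U (μ ^ (a - b))) ρ =
      Representation.mult (Representation.twist U (μ ^ a)) (Representation.twist ρ (μ ^ b)) := by
  rw [Representation.mult_twist_right, show (μ ^ b)⁻¹ = μ ^ (-b) from (zpow_neg μ b).symm,
    twist_zpow_twist_zpow, sub_eq_add_neg]

variable [FiniteDimensional k V] {g₀ : Γ}

/-- **Freeness**: an irreducible is equivalent to at most one of its `μ`-power twists of another
representation: `T ≃ U ⊗ μᵃ` and `T ≃ U ⊗ μᵇ` force `a = b` (if some `μ(g₀)` has infinite
order). [folklore] -/
theorem eq_of_equiv_twist_zpow (hμ : ¬ IsOfFinOrder (μ g₀)) {T : Representation k Γ X}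
    {U : Representation k Γ V} [U.IsIrreducible] {a b : ℤ}
    (ea : Representation.Equiv T (Representation.twist U (μ ^ a)))
    (eb : Representation.Equiv T (Representation.twist U (μ ^ b))) : a = b := by
  haveI := Representation.nontrivial_of_isIrreducible U
  obtain ⟨e⟩ := nonempty_equiv_of_twist_equiv_twist μ (ea.symm.trans eb)
  have := Representation.eq_zero_of_equiv_twist_zpow hμ e
  omega

/-- Distinct `μ`-power twists of an irreducible are non-equivalent. [folklore] -/
theorem isEmpty_equiv_twist_zpow_of_ne (hμ : ¬ IsOfFinOrder (μ g₀)) (U : Representation k Γ V)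
    [U.IsIrreducible] {a b : ℤ} (hab : a ≠ b) :
    IsEmpty (Representation.Equiv (Representation.twist U (μ ^ a))
      (Representation.twist U (μ ^ b))) :=
  ⟨fun e => hab (eq_of_equiv_twist_zpow μ hμ
    (Representation.Equiv.refl (Representation.twist U (μ ^ a))) e)⟩

end TwistPow

/-! ### Realising prescribed multiplicities by direct sums of twists -/

section Realize

variable [IsAlgClosed k] (μ : Γ →* kˣ)
  {Q : Type*} {C : Q → Type w} [∀ c, AddCommGroup (C c)] [∀ c, Module k (C c)]
  [∀ c, FiniteDimensional k (C c)] (U : ∀ c, Representation k Γ (C c)) [∀ c, (U c).IsIrreducible]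

/-- **Multiplicities of the model representation.**  Let `U_c` (`c : Q`) be irreducibles such that
`U_c ⊗ μᵃ ≃ U_{c'} ⊗ μ^{a'}` only if `(c, a) = (c', a')`.  For a finite set `K` of pairs
`(c, a)` and multiplicities `t`, the direct sum `⊕_{(c,a) ∈ K} (U_c ⊗ μᵃ)^{t(c,a)}` contains
`U_c ⊗ μᵃ` with multiplicity `t (c, a)` if `(c, a) ∈ K` and `0` otherwise. [folklore] -/
theorem mult_twist_pi_eq [DecidableEq Q]
    (hsep : ∀ c c' (a a' : ℤ), Nonempty (Representation.Equiv
      (Representation.twist (U c) (μ ^ a)) (Representation.twist (U c') (μ ^ a'))) → c = c' ∧ a = a')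
    (K : Finset (Q × ℤ)) (t : Q × ℤ → ℕ) (c : Q) (a : ℤ) :
    Representation.mult (Representation.twist (U c) (μ ^ a))
      (Representation.pi fun j : (Σ x : K, Fin (t x.1)) =>
        Representation.twist (U j.1.1.1) (μ ^ j.1.1.2)) =
      if (c, a) ∈ K then t (c, a) else 0 := by
  rw [Representation.mult_pi]
  have hterm : ∀ j : (Σ x : K, Fin (t x.1)),
      Representation.mult (Representation.twist (U c) (μ ^ a))
        (Representation.twist (U j.1.1.1) (μ ^ j.1.1.2)) = if (j.1 : Q × ℤ) = (c, a) then 1 else 0 := by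
    rintro ⟨⟨⟨c', a'⟩, hx⟩, i⟩
    rw [Representation.mult_eq_ite]
    by_cases h : ((c', a') : Q × ℤ) = (c, a)
    · rw [if_pos h]
      obtain ⟨rfl, rfl⟩ := Prod.mk.injEq _ _ _ _ |>.mp h
      exact if_pos ⟨Representation.Equiv.refl _⟩
    · rw [if_neg h, if_neg]
      rintro ⟨e⟩
      obtain ⟨rfl, rfl⟩ := hsep c c' a a' ⟨e⟩
      exact h rfl
  simp_rw [hterm]
  calc ∑ j : (Σ x : K, Fin (t x.1)), (if (j.1 : Q × ℤ) = (c, a) then 1 else 0)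
      = ∑ x : K, ∑ _i : Fin (t x.1), (if (x : Q × ℤ) = (c, a) then 1 else 0) :=
        Fintype.sum_sigma _
    _ = ∑ x : K, (if (x : Q × ℤ) = (c, a) then t x else 0) := by
        refine Finset.sum_congr rfl fun x _ => ?_
        rw [Finset.sum_const, Finset.card_univ, Fintype.card_fin, smul_eq_mul]
        split_ifs <;> simp
    _ = ∑ y ∈ K, (if y = (c, a) then t y else 0) :=
        Finset.sum_coe_sort K (fun y : Q × ℤ => if y = (c, a) then t y else 0)
    _ = if (c, a) ∈ K then t (c, a) else 0 := Finset.sum_ite_eq' K (c, a) t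

/-- Every irreducible occurring in the model `⊕ (U_c ⊗ μᵃ)^{t(c,a)}` is one of the
`U_c ⊗ μᵃ`. [folklore] -/
theorem exists_equiv_twist_of_mult_pi_pos (K : Finset (Q × ℤ)) (t : Q × ℤ → ℕ)
    {X : Type w} [AddCommGroup X] [Module k X] [FiniteDimensional k X]
    (U' : Representation k Γ X) [U'.IsIrreducible]
    (h : 0 < Representation.mult U' (Representation.pi fun j : (Σ x : K, Fin (t x.1)) =>
        Representation.twist (U j.1.1.1) (μ ^ j.1.1.2))) :
    ∃ (c : Q) (a : ℤ), Nonempty (Representation.Equiv U' (Representation.twist (U c) (μ ^ a))) := by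
  classical
  rw [Representation.mult_pi] at h
  obtain ⟨j, -, hj⟩ := Finset.exists_ne_zero_of_sum_ne_zero h.ne'
  rw [Representation.mult_eq_ite] at hj
  by_cases hne : Nonempty (Representation.Equiv U' (Representation.twist (U j.1.1.1) (μ ^ j.1.1.2)))
  · exact ⟨_, _, hne⟩
  · rw [if_neg hne] at hj
    exact absurd rfl hj

end Realize

/-- Undoing a twist on the source: `U ⊗ (μᵐ)⁻¹ ≃ W ⊗ μᵃ` gives `U ≃ W ⊗ μ^{a+m}`. [folklore] -/
theorem nonempty_equiv_of_twist_inv_equiv {V : Type w} [AddCommGroup V] [Module k V]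
    {W : Type w} [AddCommGroup W] [Module k W] (μ : Γ →* kˣ) {U : Representation k Γ V}
    {ρ : Representation k Γ W} {m a : ℤ}
    (e : Representation.Equiv (Representation.twist U (μ ^ m)⁻¹) (Representation.twist ρ (μ ^ a))) :
    Nonempty (Representation.Equiv U (Representation.twist ρ (μ ^ (a + m)))) := by
  have e' := Representation.Equiv.twist e (μ ^ m)
  rw [Representation.twist_inv_twist, twist_zpow_twist_zpow] at e'
  exact ⟨e'⟩

/-! ### The algebraic core -/

section Main

variable [IsAlgClosed k] {V : Type w} [AddCommGroup V] [Module k V] [FiniteDimensional k V]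

/-- **Twisted sums of semisimple representations: the algebraic core.**  Let `k` be
algebraically closed, `Γ` a group, `μ : Γ → kˣ` a character with `μ(g₀)` of infinite order for
some `g₀`, `ℳ ⊆ ℤ` unbounded above, and `(R_m)_{m ∈ ℳ}` finite-dimensional semisimple
representations of `Γ` on a fixed space such that for all `m₁, m₂, m₃ ∈ ℳ`
`R_{m₁} ⊗ μ^{m₂} ⊕ R_{m₂} ⊗ μ^{m₃} ⊕ R_{m₃} ⊗ μ^{m₁} ≃ R_{m₁} ⊗ μ^{m₃} ⊕ R_{m₂} ⊗ μ^{m₁} ⊕ R_{m₃} ⊗ μ^{m₂}`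
(the *three-term identity*; it holds when the characters are of the form
`χ_{R_m} = T₁ + μᵐ T₂`, by Brauer–Nesbitt).  Then there are `m₀ ∈ ℳ` and complementary
(semisimple) subrepresentations `A`, `B` of `R_{m₀}` such that `R_m ≃ A ⊕ B ⊗ μ^{m - m₀}` for all
sufficiently large `m ∈ ℳ`.  Proof: multiplicities of the `μ`-power twists of the irreducible
constituents (`Representation.exists_decomposition`, Schur), the combinatorial lemma
`TwistedSum.exists_eq_add_shift` class by class, realisation of the resulting multiplicities by
a direct sum of twists, and Krull–Schmidt (`Representation.nonempty_equiv_of_mult_eq`).  This is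
our replacement for Lemma 7.1 – Cor. 7.11 of Harris–Lan–Taylor–Thorne (who argue with the
reductive Zariski closure of the image and its central torus). [folklore] -/
theorem exists_isCompl_forall_equiv_prod_twist (μ : Γ →* kˣ) {g₀ : Γ}
    (hμ : ¬ IsOfFinOrder (μ g₀)) (ℳ : Set ℤ) (hℳ : ∀ N : ℤ, ∃ m ∈ ℳ, N ≤ m)
    (R : ℤ → Representation k Γ V) (hss : ∀ m ∈ ℳ, (R m).IsSemisimpleRepresentation)
    (h3 : ∀ m₁ ∈ ℳ, ∀ m₂ ∈ ℳ, ∀ m₃ ∈ ℳ, Nonempty (Representation.Equiv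
      ((Representation.twist (R m₁) (μ ^ m₂)).prod
        ((Representation.twist (R m₂) (μ ^ m₃)).prod (Representation.twist (R m₃) (μ ^ m₁))))
      ((Representation.twist (R m₁) (μ ^ m₃)).prod
        ((Representation.twist (R m₂) (μ ^ m₁)).prod (Representation.twist (R m₃) (μ ^ m₂)))))) :
    ∃ m₀ ∈ ℳ, ∃ A B : Subrepresentation (R m₀), IsCompl A B ∧
      A.toRepresentation.IsSemisimpleRepresentation ∧
      B.toRepresentation.IsSemisimpleRepresentation ∧
      ∃ M : ℤ, ∀ m ∈ ℳ, M ≤ m → Nonempty (Representation.Equiv (R m)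
        (A.toRepresentation.prod
          (Representation.twist B.toRepresentation (μ ^ (m - m₀))))) := by
  classical
  /- Step 1: decompositions of the `R m`, `m ∈ ℳ`, into irreducibles. -/
  have hdec : ∀ m : ℳ, ∃ (n : ℕ) (T : Fin n → Subrepresentation (R m)), n ≤ Module.finrank k V ∧
      (∀ i, (T i).toRepresentation.IsIrreducible) ∧
      ∀ {X : Type w} [AddCommGroup X] [Module k X] [FiniteDimensional k X]
        (U : Representation k Γ X) [U.IsIrreducible],
        Representation.mult U (R m) = (Finset.univ.filter fun i =>
          Nonempty (Representation.Equiv U (T i).toRepresentation)).card := by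
    intro m
    haveI := hss m m.2
    exact Representation.exists_decomposition (R m)
  choose n T hn hirr hcount using hdec
  -- all constituents, and the relation "is a `μ`-power twist of"
  haveI hirr' : ∀ x : (Σ m : ℳ, Fin (n m)), (T x.1 x.2).toRepresentation.IsIrreducible :=
    fun x => hirr x.1 x.2
  let r : (Σ m : ℳ, Fin (n m)) → (Σ m : ℳ, Fin (n m)) → Prop := fun x y =>
    ∃ a : ℤ, Nonempty (Representation.Equiv (T x.1 x.2).toRepresentation
      (Representation.twist (T y.1 y.2).toRepresentation (μ ^ a)))
  have hrefl : ∀ x, r x x := fun x =>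
    ⟨0, ⟨Representation.Equiv.ofEq (twist_zpow_zero μ (T x.1 x.2).toRepresentation).symm⟩⟩
  have hsymm : ∀ {x y}, r x y → r y x := fun ⟨a, ⟨e⟩⟩ => ⟨-a, nonempty_equiv_twist_symm μ e⟩
  have htrans : ∀ {x y z}, r x y → r y z → r x z :=
    fun ⟨a, ⟨e₁⟩⟩ ⟨b, ⟨e₂⟩⟩ => ⟨b + a, nonempty_equiv_twist_trans μ e₁ e₂⟩
  let 𝓢 : Setoid (Σ m : ℳ, Fin (n m)) := ⟨r, ⟨hrefl, hsymm, htrans⟩⟩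
  -- classes, representatives, offsets
  let cls : (Σ m : ℳ, Fin (n m)) → Quotient 𝓢 := Quotient.mk 𝓢
  let out : Quotient 𝓢 → (Σ m : ℳ, Fin (n m)) := Quotient.out
  have hout : ∀ c, cls (out c) = c := fun c => Quotient.out_eq c
  have hoff_ex : ∀ x, ∃ a : ℤ, Nonempty (Representation.Equiv (T x.1 x.2).toRepresentation
      (Representation.twist (T (out (cls x)).1 (out (cls x)).2).toRepresentation (μ ^ a))) :=
    fun x => hsymm (Quotient.mk_out x)
  choose off hoff using hoff_ex
  have key : ∀ (x : Σ m : ℳ, Fin (n m)) (c : Quotient 𝓢) (a : ℤ),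
      Nonempty (Representation.Equiv (T x.1 x.2).toRepresentation
        (Representation.twist (T (out c).1 (out c).2).toRepresentation (μ ^ a))) ↔
      cls x = c ∧ off x = a := by
    intro x c a
    constructor
    · rintro ⟨e⟩
      have hc : cls x = c := by
        rw [← hout c]
        exact Quotient.sound ⟨a, ⟨e⟩⟩
      refine ⟨hc, ?_⟩
      subst hc
      obtain ⟨e'⟩ := hoff x
      exact eq_of_equiv_twist_zpow μ hμ e' e
    · rintro ⟨rfl, rfl⟩
      exact hoff x
  /- Step 2: multiplicities of the twists `U_c ⊗ μᵃ` of the representatives in `R m` are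
  fibre cardinalities. -/
  let cnt : Quotient 𝓢 → ℳ → ℤ → ℕ := fun c m a =>
    (Finset.univ.filter fun i : Fin (n m) => cls ⟨m, i⟩ = c ∧ off ⟨m, i⟩ = a).card
  have hcnt : ∀ (c : Quotient 𝓢) (m : ℳ) (a : ℤ),
      Representation.mult (Representation.twist (T (out c).1 (out c).2).toRepresentation (μ ^ a))
        (R m) = cnt c m a := by
    intro c m a
    rw [hcount m (Representation.twist (T (out c).1 (out c).2).toRepresentation (μ ^ a))]
    refine congrArg Finset.card (Finset.filter_congr fun i _ => ?_)
    rw [← key ⟨m, i⟩ c a]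
    exact ⟨fun ⟨e⟩ => ⟨e.symm⟩, fun ⟨e⟩ => ⟨e.symm⟩⟩
  /- Step 3: the hypotheses of the combinatorial lemma, class by class. -/
  let p : Quotient 𝓢 → ℤ → ℤ → ℤ := fun c m a => if hm : m ∈ ℳ then (cnt c ⟨m, hm⟩ a : ℤ) else 0
  have hp_of_mem : ∀ (c) {m} (hm : m ∈ ℳ) (a), p c m a = cnt c ⟨m, hm⟩ a :=
    fun c m hm a => dif_pos hm
  have hp0 : ∀ c, ∀ m ∈ ℳ, ∀ a, 0 ≤ p c m a := by
    intro c m hm a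
    rw [hp_of_mem c hm]
    exact Nat.cast_nonneg _
  have hmass : ∀ c, ∀ m ∈ ℳ, ∀ s : Finset ℤ, ∑ a ∈ s, p c m a ≤ (Module.finrank k V : ℕ) := by
    intro c m hm s
    haveI := hss m hm
    have h := Representation.sum_mult_le_finrank (R m) s
      (fun a => Representation.twist (T (out c).1 (out c).2).toRepresentation (μ ^ a))
      (fun a _ => inferInstance)
      (fun a _ a' _ h => isEmpty_equiv_twist_zpow_of_ne μ hμ _ h)
    simp only [hp_of_mem c hm]
    rw [← Nat.cast_sum]
    have h' : ∑ a ∈ s, cnt c ⟨m, hm⟩ a ≤ Module.finrank k V := by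
      refine le_trans (le_of_eq (Finset.sum_congr rfl fun a _ => ?_)) h
      exact (hcnt c ⟨m, hm⟩ a).symm
    exact_mod_cast h'
  have h3p : ∀ c, ∀ m₁ ∈ ℳ, ∀ m₂ ∈ ℳ, ∀ m₃ ∈ ℳ, ∀ a : ℤ,
      p c m₁ (a - m₂) + p c m₂ (a - m₃) + p c m₃ (a - m₁) =
        p c m₁ (a - m₃) + p c m₂ (a - m₁) + p c m₃ (a - m₂) := by
    intro c m₁ hm₁ m₂ hm₂ m₃ hm₃ a
    simp only [hp_of_mem c hm₁, hp_of_mem c hm₂, hp_of_mem c hm₃, ← hcnt, mult_twist_zpow_sub μ]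
    obtain ⟨e⟩ := h3 m₁ hm₁ m₂ hm₂ m₃ hm₃
    have he := Representation.mult_congr_right
      (Representation.twist (T (out c).1 (out c).2).toRepresentation (μ ^ a)) e
    simp only [Representation.mult_prod] at he
    linarith
  have hcomb : ∀ c : Quotient 𝓢, ∃ (q₁ q₂ : ℤ → ℤ) (A M : ℤ), (∀ a, 0 ≤ q₁ a) ∧ (∀ a, 0 ≤ q₂ a) ∧
      (∀ a, A < |a| → q₁ a = 0) ∧ (∀ a, A < |a| → q₂ a = 0) ∧
      ∀ m ∈ ℳ, M ≤ m → ∀ a, p c m a = q₁ a + q₂ (a - m) :=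
    fun c => exists_eq_add_shift ℳ hℳ (Module.finrank k V) (p c) (hp0 c) (hmass c) (h3p c)
  choose q₁ q₂ A M hq₁ hq₂ hq₁A hq₂A hpq using hcomb
  /- Step 4: only the classes met in `R m₀ ⊕ R m₁` (two fixed indices) ever occur. -/
  obtain ⟨m₀, hm₀, -⟩ := hℳ 0
  obtain ⟨m₁, hm₁, hm₀₁⟩ := hℳ (m₀ + 1)
  have hne01 : m₀ ≠ m₁ := by omega
  let Crel : Finset (Quotient 𝓢) :=
    (Finset.univ.image fun i : Fin (n ⟨m₀, hm₀⟩) => cls ⟨⟨m₀, hm₀⟩, i⟩) ∪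
      (Finset.univ.image fun i : Fin (n ⟨m₁, hm₁⟩) => cls ⟨⟨m₁, hm₁⟩, i⟩)
  have hvan : ∀ c, c ∉ Crel → ∀ m ∈ ℳ, ∀ a, p c m a = 0 := by
    intro c hc
    refine eq_zero_of_three_term ℳ (Module.finrank k V) (p c) (hp0 c) (hmass c) (h3p c) hm₀ hm₁ hne01
      ?_ ?_
    · intro a
      rw [hp_of_mem c hm₀, Nat.cast_eq_zero, Finset.card_eq_zero, Finset.filter_eq_empty_iff]
      rintro i - ⟨hi, -⟩
      exact hc (Finset.mem_union_left _ (Finset.mem_image.mpr ⟨i, Finset.mem_univ _, hi⟩))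
    · intro a
      rw [hp_of_mem c hm₁, Nat.cast_eq_zero, Finset.card_eq_zero, Finset.filter_eq_empty_iff]
      rintro i - ⟨hi, -⟩
      exact hc (Finset.mem_union_right _ (Finset.mem_image.mpr ⟨i, Finset.mem_univ _, hi⟩))
  -- uniform thresholds
  let Mstar : ℤ := ∑ c ∈ Crel, |M c|
  have hMstar : ∀ c ∈ Crel, M c ≤ Mstar := fun c hc =>
    (le_abs_self _).trans (Finset.single_le_sum (fun c _ => abs_nonneg (M c)) hc)
  let Amax : ℤ := ∑ c ∈ Crel, |A c|
  have hAmax : ∀ c ∈ Crel, A c ≤ Amax := fun c hc =>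
    (le_abs_self _).trans (Finset.single_le_sum (fun c _ => abs_nonneg (A c)) hc)
  have hAmax0 : 0 ≤ Amax := Finset.sum_nonneg fun c _ => abs_nonneg (A c)
  /- Step 5: the two model representations `σ₁ = ⊕ (U_c ⊗ μᵃ)^{q₁ c a}`,
  `σ₂ = ⊕ (U_c ⊗ μᵃ)^{q₂ c a}`. -/
  let K : Finset (Quotient 𝓢 × ℤ) := Crel ×ˢ Finset.Icc (-Amax) Amax
  let t₁ : Quotient 𝓢 × ℤ → ℕ := fun y => (q₁ y.1 y.2).toNat
  let t₂ : Quotient 𝓢 × ℤ → ℕ := fun y => (q₂ y.1 y.2).toNat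
  let Uc : ∀ c : Quotient 𝓢, Representation k Γ ((T (out c).1 (out c).2).toSubmodule) :=
    fun c => (T (out c).1 (out c).2).toRepresentation
  haveI hUirr : ∀ c, (Uc c).IsIrreducible := fun c => hirr _ _
  have hsep : ∀ c c' (a a' : ℤ), Nonempty (Representation.Equiv
      (Representation.twist (Uc c) (μ ^ a)) (Representation.twist (Uc c') (μ ^ a'))) →
      c = c' ∧ a = a' := by
    rintro c c' a a' ⟨e⟩
    obtain ⟨e'⟩ := nonempty_equiv_of_twist_equiv_twist μ e
    obtain ⟨hc, ho⟩ := (key (out c) c' (a' - a)).mp ⟨e'⟩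
    have h0 : off (out c) = 0 :=
      ((key (out c) c 0).mp ⟨Representation.Equiv.ofEq (twist_zpow_zero μ _).symm⟩).2
    rw [hout] at hc
    exact ⟨hc, by omega⟩
  let σ₁ := Representation.pi fun j : (Σ x : K, Fin (t₁ x.1)) =>
    Representation.twist (Uc j.1.1.1) (μ ^ j.1.1.2)
  let σ₂ := Representation.pi fun j : (Σ x : K, Fin (t₂ x.1)) =>
    Representation.twist (Uc j.1.1.1) (μ ^ j.1.1.2)
  have hσ₁ : ∀ c a, Representation.mult (Representation.twist (Uc c) (μ ^ a)) σ₁ =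
      if (c, a) ∈ K then t₁ (c, a) else 0 := fun c a => mult_twist_pi_eq μ Uc hsep K t₁ c a
  have hσ₂ : ∀ c a, Representation.mult (Representation.twist (Uc c) (μ ^ a)) σ₂ =
      if (c, a) ∈ K then t₂ (c, a) else 0 := fun c a => mult_twist_pi_eq μ Uc hsep K t₂ c a
  -- the model multiplicities are `q₁`, `q₂` on the relevant classes
  have hK : ∀ c ∈ Crel, ∀ (q : Quotient 𝓢 → ℤ → ℤ) (t : Quotient 𝓢 × ℤ → ℕ),
      (∀ y, t y = (q y.1 y.2).toNat) → (∀ a, 0 ≤ q c a) → (∀ a, A c < |a| → q c a = 0) →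
      ∀ a, ((if (c, a) ∈ K then t (c, a) else 0 : ℕ) : ℤ) = q c a := by
    intro c hc q t ht hq0 hqA a
    by_cases ha : a ∈ Finset.Icc (-Amax) Amax
    · rw [if_pos (Finset.mem_product.mpr ⟨hc, ha⟩), ht, Int.toNat_of_nonneg (hq0 a)]
    · rw [if_neg (fun h => ha (Finset.mem_product.mp h).2), Nat.cast_zero, eq_comm]
      apply hqA
      rw [Finset.mem_Icc, not_and_or, not_le, not_le] at ha
      have := hAmax c hc
      rcases ha with ha | ha
      · rw [abs_of_neg (by linarith)]; linarith
      · rw [abs_of_pos (by linarith)]; linarith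
  /- Step 6: `R m` and `σ₁ ⊕ σ₂ ⊗ μᵐ` have the same multiplicities, for large `m ∈ ℳ`. -/
  have hE : ∀ m (hm : m ∈ ℳ), Mstar ≤ m → ∀ (c) (a : ℤ),
      Representation.mult (Representation.twist (Uc c) (μ ^ a)) (R m) =
        Representation.mult (Representation.twist (Uc c) (μ ^ a))
          (σ₁.prod (Representation.twist σ₂ (μ ^ m))) := by
    intro m hm hMm c a
    rw [Representation.mult_prod, ← mult_twist_zpow_sub μ, hσ₁, hσ₂, hcnt c ⟨m, hm⟩ a]
    apply Nat.cast_injective (R := ℤ)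
    rw [← hp_of_mem c hm, Nat.cast_add]
    by_cases hc : c ∈ Crel
    · rw [hK c hc q₁ t₁ (fun _ => rfl) (hq₁ c) (hq₁A c) a,
        hK c hc q₂ t₂ (fun _ => rfl) (hq₂ c) (hq₂A c) (a - m)]
      exact hpq c m hm ((hMstar c hc).trans hMm) a
    · rw [hvan c hc m hm a, if_neg (fun h => hc (Finset.mem_product.mp h).1),
        if_neg (fun h => hc (Finset.mem_product.mp h).1)]
      simp
  have hmain : ∀ m (hm : m ∈ ℳ), Mstar ≤ m →
      ∀ {X : Type w} [AddCommGroup X] [Module k X] [FiniteDimensional k X]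
        (U' : Representation k Γ X) [U'.IsIrreducible],
        Representation.mult U' (R m) =
          Representation.mult U' (σ₁.prod (Representation.twist σ₂ (μ ^ m))) := by
    intro m hm hMm X _ _ _ U' _
    by_cases hU' : ∃ (c : Quotient 𝓢) (a : ℤ),
        Nonempty (Representation.Equiv U' (Representation.twist (Uc c) (μ ^ a)))
    · obtain ⟨c, a, ⟨e⟩⟩ := hU'
      rw [Representation.mult_congr_left e, Representation.mult_congr_left e]
      exact hE m hm hMm c a
    · have h1 : Representation.mult U' (R m) = 0 := by
        rw [hcount ⟨m, hm⟩ U', Finset.card_eq_zero, Finset.filter_eq_empty_iff]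
        rintro i - ⟨e⟩
        obtain ⟨e'⟩ := hoff ⟨⟨m, hm⟩, i⟩
        exact hU' ⟨_, _, ⟨e.trans e'⟩⟩
      have h2 : Representation.mult U' (σ₁.prod (Representation.twist σ₂ (μ ^ m))) = 0 := by
        rw [Representation.mult_prod, Nat.add_eq_zero_iff]
        constructor
        · by_contra h
          obtain ⟨c, a, ha⟩ :=
            exists_equiv_twist_of_mult_pi_pos μ Uc K t₁ U' (Nat.pos_of_ne_zero h)
          exact hU' ⟨c, a, ha⟩
        · by_contra h
          rw [Representation.mult_twist_right] at h
          obtain ⟨c, a, ⟨e⟩⟩ :=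
            exists_equiv_twist_of_mult_pi_pos μ Uc K t₂ _ (Nat.pos_of_ne_zero h)
          exact hU' ⟨c, a + m, nonempty_equiv_of_twist_inv_equiv μ e⟩
      rw [h1, h2]
  have hequiv : ∀ m (hm : m ∈ ℳ), Mstar ≤ m → Nonempty (Representation.Equiv (R m)
      (σ₁.prod (Representation.twist σ₂ (μ ^ m)))) := by
    intro m hm hMm
    haveI := hss m hm
    exact Representation.nonempty_equiv_of_mult_eq (R m) _ (hmain m hm hMm)
  /- Step 7: internal form in `R m₀` for a fixed large `m₀ ∈ ℳ`. -/
  obtain ⟨ms, hms, hMms⟩ := hℳ Mstar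
  obtain ⟨e⟩ := hequiv ms hms hMms
  let f₁ : Representation.IntertwiningMap σ₁ (R ms) := e.symm.toIntertwiningMap.comp
    (Representation.IntertwiningMap.inl k σ₁ (Representation.twist σ₂ (μ ^ ms)))
  let f₂ : Representation.IntertwiningMap (Representation.twist σ₂ (μ ^ ms)) (R ms) :=
    e.symm.toIntertwiningMap.comp
      (Representation.IntertwiningMap.inr k σ₁ (Representation.twist σ₂ (μ ^ ms)))
  have hf₁ : Function.Injective f₁ := fun x y hxy =>
    LinearMap.inl_injective (e.symm.injective hxy)
  have hf₂ : Function.Injective f₂ := fun x y hxy =>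
    LinearMap.inr_injective (e.symm.injective hxy)
  let A : Subrepresentation (R ms) := f₁.range
  let B : Subrepresentation (R ms) := f₂.range
  have eA : Representation.Equiv σ₁ A.toRepresentation := Subrepresentation.equivRange f₁ hf₁
  have eB : Representation.Equiv (Representation.twist σ₂ (μ ^ ms)) B.toRepresentation :=
    Subrepresentation.equivRange f₂ hf₂
  have hAB : IsCompl A B := by
    rw [Subrepresentation.isCompl_iff]
    have hA : A.toSubmodule = Submodule.map e.symm.toLinearEquiv.toLinearMap
        (LinearMap.range (LinearMap.inl k _ _)) := by
      rw [← LinearMap.range_comp]; rfl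
    have hB : B.toSubmodule = Submodule.map e.symm.toLinearEquiv.toLinearMap
        (LinearMap.range (LinearMap.inr k _ _)) := by
      rw [← LinearMap.range_comp]; rfl
    rw [hA, hB]
    exact (Submodule.orderIsoMapComap e.symm.toLinearEquiv).isCompl LinearMap.isCompl_range_inl_inr
  refine ⟨ms, hms, A, B, hAB, Representation.isSemisimpleRepresentation_of_equiv eA,
    Representation.isSemisimpleRepresentation_of_equiv eB, Mstar, fun m hm hMm => ?_⟩
  obtain ⟨em⟩ := hequiv m hm hMm
  have e2 : Representation.Equiv (Representation.twist σ₂ (μ ^ m))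
      (Representation.twist B.toRepresentation (μ ^ (m - ms))) :=
    (Representation.Equiv.ofEq (by rw [twist_zpow_twist_zpow, add_sub_cancel])).trans
      (Representation.Equiv.twist eB (μ ^ (m - ms)))
  exact ⟨em.trans (Representation.Equiv.prodCongr eA e2)⟩

end Main

end TwistedSum

end Literature.NumberTheory.GaloisRepresentations
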